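import Summits.Ventures.Crystal3D.Theorems.StickyWulffConstantTextureLiminfTexShadowSteerCombo
import HarnessLib

/-!
# TexShadow row (e) / EDGE-ON flux sliver: the best IN-LAYER bond of a plate rises by `≥ (√3/2)·sin β` along the wall normal
# (lane T, crux `TextureLiminfV5`, stmt-Ventures-23912; cf-p1 (cxcvii)(b) commission 2026-08-29T10:12:06Z — first signature of the candidate payer «in-layer walker families»)

HONEST FRAMING. Venture `Summits/Ventures/Crystal3D` (cell `crystal3d-full`), route `route-Ventures-StickyWulffConstant`, helper
`--supports` the law-v5 crux `TextureLiminfV5` (stmt-Ventures-23912).  Elementary planar geometry; standard axioms; NO walker or certificate is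
asserted; rung F-C1 not moved.

THE POINT.  The walker ledgers step along INTER-layer bonds only (three up-slots on Δ-bilayers, three cappers on ∇-bilayers).  For a nearly
edge-on plate these rise little along the wall normal `e` (`≤ 1/√3`, and `1/(2√3)` on ∇-bilayers in the azimuth window of the flux-pair sliver
`FluxPairFailAt`), whereas the six IN-LAYER bonds of the same site then point steeply up the wall.  Writing `ν = L⁻¹e = (ν_h, ν₂)`,
`ν₂ = ⟪L e₃, e⟫ = cos β`, `|ν_h| = sin β`:
* `exists_inPlane_slot_inner_ge` — for every `w ∈ ℝ³` some in-layer slot `u` (`u ∈ fccSlots`, `u₂ = 0`) has `⟪u, w⟫ ≥ (√3/2)·√(w₀² + w₁²)` (six unit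
  vectors at `60°`: covering angle `30°` in the plane);
* **`exists_inPlane_slot_rise_ge`** — for every frame `L` and unit `e` some in-layer slot `u` has `⟪L u, e⟫ ≥ (√3/2)·√(1 − ⟪L e₃, e⟫²) = (√3/2)·sin β`.
So at tilt `β ≥ 75°` (the sliver band) the best in-layer bond rises by `≥ 0.836 > √2·13/25 = 0.7354`: the ONE-SIDED flux threshold, on every bilayer
type.  Whether an in-layer STEP can be certified by a walk machine (window = the P5 hemisphere of `u`, end ⇒ deficiency via E1) is lane G's question;
this file only records the geometric launch fact.
WHAT THIS IS NOT: no walker, no certificate, no claim about the sliver's closure; F-C1 not moved.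
-/

noncomputable section

open scoped BigOperators InnerProductSpace ENNReal
open MeasureTheory Filter

namespace Summit.Ventures.Crystal3D.Cruxes.TextureLiminf.TexShadow

open Summit.Ventures.Crystal3D Summit.Ventures.Crystal3D.Theorems
open Literature.MathematicalPhysics.StatisticalMechanics (IsHaggSeq fccStacking barlowStacking barlowPos constHagg haggLabel_const
  barlowPos_apply_zero barlowPos_apply_one barlowPos_apply_two)

/-! ## The six in-layer slots -/

/-- The in-layer site `barlowPos 0 i j` (fcc labels) has coordinates `(i + j/2, (√3/2)·j, 0)`. -/
theorem barlowPos_zero_coord (i j : ℤ) :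
    barlowPos 1 (Real.sqrt (2 / 3)) constHagg 0 i j 0 = i + j / 2 ∧
      barlowPos 1 (Real.sqrt (2 / 3)) constHagg 0 i j 1 = Real.sqrt 3 / 2 * j ∧
      barlowPos 1 (Real.sqrt (2 / 3)) constHagg 0 i j 2 = 0 := by
  refine ⟨?_, ?_, ?_⟩
  · rw [barlowPos_apply_zero, haggLabel_const]; push_cast; ring
  · rw [barlowPos_apply_one, haggLabel_const]; push_cast; ring
  · rw [barlowPos_apply_two]; push_cast; ring

/-- The in-layer sites `(0, 1, 0)`, `(0, 0, 1)`, `(0, −1, 1)` and their negatives are slots. -/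
theorem inPlane_mem_fccSlots :
    barlowPos 1 (Real.sqrt (2 / 3)) constHagg 0 1 0 ∈ fccSlots ∧ barlowPos 1 (Real.sqrt (2 / 3)) constHagg 0 0 1 ∈ fccSlots ∧
      barlowPos 1 (Real.sqrt (2 / 3)) constHagg 0 (-1) 1 ∈ fccSlots ∧ barlowPos 1 (Real.sqrt (2 / 3)) constHagg 0 (-1) 0 ∈ fccSlots ∧
      barlowPos 1 (Real.sqrt (2 / 3)) constHagg 0 0 (-1) ∈ fccSlots ∧ barlowPos 1 (Real.sqrt (2 / 3)) constHagg 0 1 (-1) ∈ fccSlots := by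
  refine ⟨?_, ?_, ?_, ?_, ?_, ?_⟩ <;> rw [fccSlots, Finset.mem_image]
  · exact ⟨(0, 1, 0), by simp [fccSlotTriples], rfl⟩
  · exact ⟨(0, 0, 1), by simp [fccSlotTriples], rfl⟩
  · exact ⟨(0, -1, 1), by simp [fccSlotTriples], rfl⟩
  · exact ⟨(0, -1, 0), by simp [fccSlotTriples], rfl⟩
  · exact ⟨(0, 0, -1), by simp [fccSlotTriples], rfl⟩
  · exact ⟨(0, 1, -1), by simp [fccSlotTriples], rfl⟩

/-- Inner product of an in-layer site with `w`: `(i + j/2)·w₀ + (√3/2)·j·w₁`. -/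
theorem inner_barlowPos_zero (i j : ℤ) (w : E3) :
    ⟪barlowPos 1 (Real.sqrt (2 / 3)) constHagg 0 i j, w⟫_ℝ = (i + j / 2) * w 0 + Real.sqrt 3 / 2 * j * w 1 := by
  obtain ⟨h0, h1, h2⟩ := barlowPos_zero_coord i j
  rw [inner_axial_lateral, h0, h1, h2]
  ring

/-! ## The planar covering inequality -/

/-- **Planar core**: with `p₁ = x`, `p₂ = x/2 + (√3/2)y`, `p₃ = −x/2 + (√3/2)y` one of `p₁², p₂², p₃²` is `≥ (3/4)(x² + y²)`. -/
theorem three_axes_sq_core (x y : ℝ) :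
    3 / 4 * (x ^ 2 + y ^ 2) ≤ x ^ 2 ∨ 3 / 4 * (x ^ 2 + y ^ 2) ≤ (x / 2 + Real.sqrt 3 / 2 * y) ^ 2 ∨
      3 / 4 * (x ^ 2 + y ^ 2) ≤ (-(x / 2) + Real.sqrt 3 / 2 * y) ^ 2 := by
  have h3 : Real.sqrt 3 ^ 2 = 3 := Real.sq_sqrt (by norm_num)
  set p₂ := x / 2 + Real.sqrt 3 / 2 * y with hp₂
  set p₃ := -(x / 2) + Real.sqrt 3 / 2 * y with hp₃
  have hx : x = p₂ - p₃ := by rw [hp₂, hp₃]; ring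
  have hkey : 3 / 4 * (x ^ 2 + y ^ 2) = p₂ ^ 2 + p₃ ^ 2 - p₂ * p₃ := by
    rw [hp₂, hp₃]; nlinarith [h3]
  rw [hkey, hx]
  rcases le_or_gt (p₂ * p₃) 0 with h | h
  · left; nlinarith
  · right
    rcases le_or_gt (p₃ ^ 2) (p₂ ^ 2) with h' | h'
    · left; nlinarith
    · right; nlinarith

/-- From `c² ≤ p²` with `c ≥ 0`: `c ≤ p` or `c ≤ −p`. -/
theorem le_or_le_neg_of_sq_le {c p : ℝ} (hc : 0 ≤ c) (h : c ^ 2 ≤ p ^ 2) : c ≤ p ∨ c ≤ -p := by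
  have habs : |c| ≤ |p| := sq_le_sq.1 h
  rw [abs_of_nonneg hc] at habs
  rcases le_or_gt 0 p with hp | hp
  · left; rwa [abs_of_nonneg hp] at habs
  · right; rwa [abs_of_neg hp] at habs

/-- **Some in-layer slot is within `30°` of the horizontal part of `w`**: `∃ u ∈ fccSlots, u₂ = 0 ∧ ⟪u, w⟫ ≥ (√3/2)·√(w₀² + w₁²)`. -/
theorem exists_inPlane_slot_inner_ge (w : E3) :
    ∃ u ∈ fccSlots, u 2 = 0 ∧ Real.sqrt 3 / 2 * Real.sqrt (w 0 ^ 2 + w 1 ^ 2) ≤ ⟪u, w⟫_ℝ := by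
  obtain ⟨m₁, m₂, m₃, m₄, m₅, m₆⟩ := inPlane_mem_fccSlots
  have h3 : Real.sqrt 3 ^ 2 = 3 := Real.sq_sqrt (by norm_num)
  set c := Real.sqrt 3 / 2 * Real.sqrt (w 0 ^ 2 + w 1 ^ 2) with hc_def
  have hc : 0 ≤ c := by positivity
  have hc2 : c ^ 2 = 3 / 4 * (w 0 ^ 2 + w 1 ^ 2) := by
    rw [hc_def, mul_pow, Real.sq_sqrt (by positivity), div_pow, h3]; ring
  -- the six inner products
  have e₁ : ⟪barlowPos 1 (Real.sqrt (2 / 3)) constHagg 0 1 0, w⟫_ℝ = w 0 := by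
    rw [inner_barlowPos_zero]; push_cast; ring
  have e₂ : ⟪barlowPos 1 (Real.sqrt (2 / 3)) constHagg 0 0 1, w⟫_ℝ = w 0 / 2 + Real.sqrt 3 / 2 * w 1 := by
    rw [inner_barlowPos_zero]; push_cast; ring
  have e₃' : ⟪barlowPos 1 (Real.sqrt (2 / 3)) constHagg 0 (-1) 1, w⟫_ℝ = -(w 0 / 2) + Real.sqrt 3 / 2 * w 1 := by
    rw [inner_barlowPos_zero]; push_cast; ring
  have e₄ : ⟪barlowPos 1 (Real.sqrt (2 / 3)) constHagg 0 (-1) 0, w⟫_ℝ = -w 0 := by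
    rw [inner_barlowPos_zero]; push_cast; ring
  have e₅ : ⟪barlowPos 1 (Real.sqrt (2 / 3)) constHagg 0 0 (-1), w⟫_ℝ = -(w 0 / 2 + Real.sqrt 3 / 2 * w 1) := by
    rw [inner_barlowPos_zero]; push_cast; ring
  have e₆ : ⟪barlowPos 1 (Real.sqrt (2 / 3)) constHagg 0 1 (-1), w⟫_ℝ = -(-(w 0 / 2) + Real.sqrt 3 / 2 * w 1) := by
    rw [inner_barlowPos_zero]; push_cast; ring
  have z : ∀ i j : ℤ, barlowPos 1 (Real.sqrt (2 / 3)) constHagg 0 i j 2 = 0 := fun i j => (barlowPos_zero_coord i j).2.2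
  rcases three_axes_sq_core (w 0) (w 1) with h | h | h
  · rcases le_or_le_neg_of_sq_le hc (hc2.symm ▸ h) with h' | h'
    · exact ⟨_, m₁, z 1 0, by rw [e₁]; exact h'⟩
    · exact ⟨_, m₄, z (-1) 0, by rw [e₄]; exact h'⟩
  · rcases le_or_le_neg_of_sq_le hc (hc2.symm ▸ h) with h' | h'
    · exact ⟨_, m₂, z 0 1, by rw [e₂]; exact h'⟩
    · exact ⟨_, m₅, z 0 (-1), by rw [e₅]; exact h'⟩
  · rcases le_or_le_neg_of_sq_le hc (hc2.symm ▸ h) with h' | h'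
    · exact ⟨_, m₃, z (-1) 1, by rw [e₃']; exact h'⟩
    · exact ⟨_, m₆, z 1 (-1), by rw [e₆]; exact h'⟩

/-- **The best in-layer bond rises by `≥ (√3/2)·sin β` along `e`**: for every frame `L` and unit `e` some in-layer slot `u` (`u ∈ fccSlots`, `u₂ = 0`)
has `⟪L u, e⟫ ≥ (√3/2)·√(1 − ⟪L e₃, e⟫²)`.  At tilt `β ≥ 75°` (`⟪L e₃, e⟫ ≤ cos 75°`) this is `≥ 0.836 > √2·13/25`. -/
theorem exists_inPlane_slot_rise_ge (L : E3 ≃ₗᵢ[ℝ] E3) {e : E3} (he : ‖e‖ = 1) :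
    ∃ u ∈ fccSlots, u 2 = 0 ∧ Real.sqrt 3 / 2 * Real.sqrt (1 - ⟪L e₃, e⟫_ℝ ^ 2) ≤ ⟪L u, e⟫_ℝ := by
  set w : E3 := L.symm e with hw_def
  have hw : ‖w‖ = 1 := by rw [hw_def, LinearIsometryEquiv.norm_map, he]
  have hLw : ∀ x : E3, ⟪L x, e⟫_ℝ = ⟪x, w⟫_ℝ := fun x => by
    rw [hw_def, ← LinearIsometryEquiv.inner_map_map L x (L.symm e), LinearIsometryEquiv.apply_symm_apply]
  have hw2 : ⟪L e₃, e⟫_ℝ = w 2 := by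
    rw [hLw]
    show ⟪EuclideanSpace.single (2 : Fin 3) (1 : ℝ), w⟫_ℝ = w 2
    rw [EuclideanSpace.inner_single_left]; simp
  have hsq : w 0 ^ 2 + w 1 ^ 2 = 1 - ⟪L e₃, e⟫_ℝ ^ 2 := by
    have h := EuclideanSpace.real_norm_sq_eq w
    rw [hw, Fin.sum_univ_three] at h
    rw [hw2]; nlinarith [h]
  obtain ⟨u, hu, hu0, hge⟩ := exists_inPlane_slot_inner_ge w
  refine ⟨u, hu, hu0, ?_⟩
  rw [← hsq, hLw u]
  exact hge

/-- Numerical corollary for the sliver band: if `⟪L e₃, e⟫² ≤ 1/4` (tilt `β ≥ 60°`) then some in-layer slot rises by `≥ 3/4 > √2·13/25`. -/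
theorem exists_inPlane_slot_rise_ge_three_quarters (L : E3 ≃ₗᵢ[ℝ] E3) {e : E3} (he : ‖e‖ = 1) (hβ : ⟪L e₃, e⟫_ℝ ^ 2 ≤ 1 / 4) :
    ∃ u ∈ fccSlots, u 2 = 0 ∧ (3 / 4 : ℝ) ≤ ⟪L u, e⟫_ℝ := by
  obtain ⟨u, hu, hu0, hge⟩ := exists_inPlane_slot_rise_ge L he
  refine ⟨u, hu, hu0, le_trans ?_ hge⟩
  have h3 : Real.sqrt 3 ^ 2 = 3 := Real.sq_sqrt (by norm_num)
  have hs : Real.sqrt 3 / 2 ≤ Real.sqrt (1 - ⟪L e₃, e⟫_ℝ ^ 2) := by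
    rw [show Real.sqrt 3 / 2 = Real.sqrt (3 / 4) by
      rw [Real.sqrt_div' 3 (by norm_num : (0:ℝ) ≤ 4), show Real.sqrt 4 = 2 by
        rw [show (4:ℝ) = 2 ^ 2 by norm_num, Real.sqrt_sq (by norm_num)]]]
    exact Real.sqrt_le_sqrt (by linarith)
  have hs0 : 0 ≤ Real.sqrt 3 / 2 := by positivity
  calc (3 / 4 : ℝ) = Real.sqrt 3 / 2 * (Real.sqrt 3 / 2) := by nlinarith [h3]
    _ ≤ Real.sqrt 3 / 2 * Real.sqrt (1 - ⟪L e₃, e⟫_ℝ ^ 2) := mul_le_mul_of_nonneg_left hs hs0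

/-- `√2·(13/25) < 3/4`: the in-layer rise at tilt `≥ 60°` clears the one-sided flux threshold of the law. -/
theorem sqrt_two_mul_c0_lt_three_quarters : Real.sqrt 2 * (13 / 25) < 3 / 4 := by
  have h2 : Real.sqrt 2 < 1.4143 := by
    rw [show (1.4143 : ℝ) = Real.sqrt (1.4143 ^ 2) by rw [Real.sqrt_sq (by norm_num)]]
    exact Real.sqrt_lt_sqrt (by norm_num) (by norm_num)
  nlinarith [Real.sqrt_nonneg 2]

end Summit.Ventures.Crystal3D.Cruxes.TextureLiminf.TexShadow

end
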